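import Summits.FinalStateConjecture.FinalStateConjecture.Theorems.BartnikGapSettlingBondiBartnikRigiditySlabCauchyRigidityLensCauchy
import HarnessLib

/-!
# K2b-2 `SlabFrontier`, brick 1: clocks along future CAUSAL curves of the Kerr star chart — line
# `direct-method-on-the-cone` (crux `BondiBartnikRigidity`, stmt-FinalStateConjecture-10807)

Kinematics of future-directed causal (not only timelike) curves `γ` of the ingoing Kerr–Schild star
chart `Kerr.region a M = {r > M}` (`0 ≤ M`, `|a| < M`), the curve-level input of the frontier
statement `K2Route.SlabFrontier` (whose causal futures `J⁺` are generated by causal curves):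

* `causal_velocity` — the coordinate curve is differentiable, `g(v, v) ≤ 0` and `v⁰ > 0`
  (`g(−g♯dt*, v) = −v⁰`, `Kerr.bilin_timeVector`): `t*` is a time function (`strictMonoOn_time`);
* `norm_spatial_deriv_le` — the Kerr–Schild speed limit `‖v⃗‖_δ ≤ v⁰` (`η(v, v) ≤ g(v, v)`,
  `spatial_sq_le_of_causal`), whence `|ṙ| < (3/2) v⁰` (`|∇r|_δ ≤ √2`, `F1Route.abs_radiusGrad_le`)
  and the clocks `t* + c r`, `|c| ≤ 2/3`, are strictly increasing (`strictMonoOn_clock`; the timelike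
  case is `F1Route.strictMonoOn_clock`);
* `strictAntiOn_radius` — the hole clock: `r` is strictly decreasing while `r₋ < r < r₊`
  (`CollarCauchy.clock_neg`, `CollarCauchy.exists_hole_slope`), and its integrated form
  `radius_le_of_radius_lt_rPlus`: a future causal curve starting in `{r < r₊}` never exceeds its
  initial radius (continuous induction), so `J⁺` of a set inside the black hole stays inside.

References: Dafermos–Rodnianski arXiv:0811.0354, §5.1 [DafermosRodnianski2008]; O'Neill 1983, Ch. 5,
Lemma 5.29, Ch. 14, p. 402 [ONeill1983]; O'Neill 1995, Ch. 2 [ONeill1995]; Visser arXiv:0706.0622, (35)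
[arXiv07060622].  No definitions, no named facts.
-/

noncomputable section

-- D-0017: single-problem summit, `Summit.<S>.<S>.…` by design (cf. lakefile `weak.linter.dupNamespace`).
set_option linter.dupNamespace false

open Set Filter Function Topology TopologicalSpace
open Literature.Geometry.Lorentzian
open scoped Manifold ContDiff Topology RealInnerProductSpace
open Summit.FinalStateConjecture.FinalStateConjecture.Theorems.SwallowTheDatum.KerrShieldedSettles.CollarCauchy
  (velocity_eq_deriv clock_neg exists_hole_slope)
open Summit.FinalStateConjecture.FinalStateConjecture.Theorems.KerrShieldedSettles.Negative
  (spatial_sq_le_of_causal)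

namespace Summit.FinalStateConjecture.FinalStateConjecture.Theorems.BondiBartnikRigidity.DirectMethod

namespace KerrCausal

variable [Kerr.Facts] {M a : ℝ} {hM : 0 ≤ M} {γ : ℝ → Kerr.region a M} {s : Set ℝ}

/-! ### The velocity of a future causal curve of the chart -/

/-- Along a future causal curve of the Kerr chart the coordinate curve is differentiable with velocity
`v`, `g(v, v) ≤ 0` and `v⁰ > 0` (future-directed for `−g♯dt*`: `g(−g♯dt*, v) = −v⁰ < 0`).
[cite: DafermosRodnianski2008, §5.1] -/
theorem causal_velocity (hγ : (Kerr.smoothMetric M a M).IsFutureCausalCurveOn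
      ((Kerr.timeOrientation M a M hM).ofLE le_top) γ s) {t : ℝ} (ht : t ∈ s) :
    HasDerivAt (fun σ => (γ σ : E4)) (deriv (fun σ => (γ σ : E4)) t) t ∧
      Kerr.bilin M a (γ t) (deriv (fun σ => (γ σ : E4)) t) (deriv (fun σ => (γ σ : E4)) t) ≤ 0 ∧
      0 < deriv (fun σ => (γ σ : E4)) t 0 := by
  obtain ⟨hd, ⟨hc, -⟩, hfd⟩ := hγ t ht
  have hd' : DifferentiableAt ℝ (fun σ => (γ σ : E4)) t :=
    mdifferentiableAt_iff_differentiableAt.mp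
      ((mdifferentiableAt_subtypeVal_comp_curve_iff (I := 𝓘(ℝ, E4)) (Kerr.region a M)).2 hd)
  have hv := velocity_eq_deriv γ t
  have hx : 0 < Kerr.radius a (γ t) := Kerr.radius_pos_of_mem_region (γ t).2
  refine ⟨hd'.hasDerivAt, ?_, ?_⟩
  · have h1 : Kerr.bilin M a (γ t) (velocity 𝓘(ℝ, E4) γ t) (velocity 𝓘(ℝ, E4) γ t) ≤ 0 := hc
    rwa [hv] at h1
  · have h2 : Kerr.bilin M a (γ t) (Kerr.timeVector M a (γ t)) (velocity 𝓘(ℝ, E4) γ t) < 0 := hfd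
    rw [hv, Kerr.bilin_timeVector hx] at h2
    linarith

/-- **Speed limit**: along a future causal curve of the chart `‖v⃗‖_δ ≤ v⁰` (`η(v, v) ≤ g(v, v) ≤ 0`
since `H ≥ 0`). [cite: DafermosRodnianski2008, §5.1] -/
theorem norm_spatial_deriv_le (hγ : (Kerr.smoothMetric M a M).IsFutureCausalCurveOn
      ((Kerr.timeOrientation M a M hM).ofLE le_top) γ s) {t : ℝ} (ht : t ∈ s) :
    ‖E4.spatial (deriv (fun σ => (γ σ : E4)) t)‖ ≤ deriv (fun σ => (γ σ : E4)) t 0 := by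
  obtain ⟨-, hc, hv0⟩ := causal_velocity hγ ht
  set v : E4 := deriv (fun σ => (γ σ : E4)) t with hv
  have h := spatial_sq_le_of_causal hM a (γ t : E4) v hc
  have hsq : ‖E4.spatial v‖ ^ 2 = v 1 ^ 2 + v 2 ^ 2 + v 3 ^ 2 := by
    rw [EuclideanSpace.real_norm_sq_eq, Fin.sum_univ_three]
    simp only [E4.spatial_apply]
    rfl
  exact le_of_pow_le_pow_left₀ two_ne_zero hv0.le (by rw [hsq]; exact h)

/-- The time coordinate along a future causal curve of the chart has derivative `v⁰`. [folklore] -/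
theorem hasDerivAt_time (hγ : (Kerr.smoothMetric M a M).IsFutureCausalCurveOn
      ((Kerr.timeOrientation M a M hM).ofLE le_top) γ s) {t : ℝ} (ht : t ∈ s) :
    HasDerivAt (fun σ => (γ σ : E4) 0) (deriv (fun σ => (γ σ : E4)) t 0) t := by
  have h1 := (causal_velocity hγ ht).1
  have := ((EuclideanSpace.proj (0 : Fin 4) : E4 →L[ℝ] ℝ).hasFDerivAt.comp_hasDerivAt t h1)
  simpa [Function.comp_def] using this

/-- **`t*` is a time function**: strictly increasing along future causal curves of the chart on an
interval (`ṫ* = v⁰ > 0`). [cite: DafermosRodnianski2008, §5.1] -/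
theorem strictMonoOn_time (hs : s.OrdConnected) (hγ : (Kerr.smoothMetric M a M).IsFutureCausalCurveOn
      ((Kerr.timeOrientation M a M hM).ofLE le_top) γ s) :
    StrictMonoOn (fun σ => (γ σ : E4) 0) s := by
  refine strictMonoOn_of_deriv_pos hs.convex
    (fun t ht => (hasDerivAt_time hγ ht).continuousAt.continuousWithinAt) fun t ht => ?_
  rw [(hasDerivAt_time hγ (interior_subset ht)).deriv]
  exact (causal_velocity hγ (interior_subset ht)).2.2

/-- `d/dσ r(γ σ) = dr(v⃗)` along a future causal curve (chain rule with `Kerr.hasFDerivAt_radius`).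
[folklore] -/
theorem hasDerivAt_radius (hγ : (Kerr.smoothMetric M a M).IsFutureCausalCurveOn
      ((Kerr.timeOrientation M a M hM).ofLE le_top) γ s) {t : ℝ} (ht : t ∈ s) :
    HasDerivAt (fun σ => Kerr.radius a (γ σ))
      (Kerr.radiusGrad a (E4.spatial (γ t : E4)) (E4.spatial (deriv (fun σ => (γ σ : E4)) t))) t := by
  have h1 := (causal_velocity hγ ht).1
  have hx : 0 < Kerr.radius a (γ t) := Kerr.radius_pos_of_mem_region (γ t).2
  have := (Kerr.hasFDerivAt_radius hx).comp_hasDerivAt t h1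
  simpa [Function.comp_def] using this

/-- Along a future causal curve of the chart `{r > M}`, `|a| < M`: `|ṙ| < (3/2) v⁰` (indeed `≤ √2 v⁰`),
from the speed limit and `|∇r|_δ ≤ √2` (`F1Route.abs_radiusGrad_le`). [cite: arXiv07060622, (35)] -/
theorem abs_deriv_radius_lt (ha : |a| < M) (hγ : (Kerr.smoothMetric M a M).IsFutureCausalCurveOn
      ((Kerr.timeOrientation M a M hM).ofLE le_top) γ s) {t : ℝ} (ht : t ∈ s) :
    |Kerr.radiusGrad a (E4.spatial (γ t : E4)) (E4.spatial (deriv (fun σ => (γ σ : E4)) t))| <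
      3 / 2 * deriv (fun σ => (γ σ : E4)) t 0 := by
  obtain ⟨-, -, hv0⟩ := causal_velocity hγ ht
  have hsp := norm_spatial_deriv_le hγ ht
  have hr' : 0 < Kerr.radius a (E4.ofTimeSpace 0 (E4.spatial (γ t : E4))) := by
    rw [Kerr.radius_ofTimeSpace_spatial]
    exact Kerr.radius_pos_of_mem_region (γ t).2
  have har : |a| ≤ Kerr.radius a (E4.ofTimeSpace 0 (E4.spatial (γ t : E4))) := by
    rw [Kerr.radius_ofTimeSpace_spatial]
    exact (ha.trans (Kerr.lt_radius_of_mem_region (γ t).2)).le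
  have h1 := F1Route.abs_radiusGrad_le hr' har (E4.spatial (deriv (fun σ => (γ σ : E4)) t))
  have hsqrt : Real.sqrt 2 < 3 / 2 := by
    rw [show (3 / 2 : ℝ) = Real.sqrt ((3 / 2) ^ 2) by rw [Real.sqrt_sq]; norm_num]
    exact Real.sqrt_lt_sqrt (by norm_num) (by norm_num)
  have h2 : Real.sqrt 2 * ‖E4.spatial (deriv (fun σ => (γ σ : E4)) t)‖ ≤
      Real.sqrt 2 * deriv (fun σ => (γ σ : E4)) t 0 :=
    mul_le_mul_of_nonneg_left hsp (Real.sqrt_nonneg _)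
  nlinarith [Real.sqrt_nonneg 2, mul_pos (sub_pos.2 hsqrt) hv0]

/-! ### The clocks `t* + c r` and the hole clock along causal curves -/

/-- The derivative of the clock `σ ↦ t*(γ σ) + c r(γ σ)` along a future causal curve. [folklore] -/
theorem hasDerivAt_clock (c : ℝ) (hγ : (Kerr.smoothMetric M a M).IsFutureCausalCurveOn
      ((Kerr.timeOrientation M a M hM).ofLE le_top) γ s) {t : ℝ} (ht : t ∈ s) :
    HasDerivAt (fun σ => (γ σ : E4) 0 + c * Kerr.radius a (γ σ))
      (deriv (fun σ => (γ σ : E4)) t 0 + c *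
        Kerr.radiusGrad a (E4.spatial (γ t : E4)) (E4.spatial (deriv (fun σ => (γ σ : E4)) t))) t :=
  (hasDerivAt_time hγ ht).add ((hasDerivAt_radius hγ ht).const_mul c)

/-- **The clocks along causal curves**: for `|c| ≤ 2/3` the function `t* + c r` is strictly increasing
along future causal curves of the chart `{r > M}`, `|a| < M`, on an interval (derivative
`v⁰ + c ṙ ≥ v⁰ − |c| |ṙ| > 0`).  In particular the level sets of `3A − 2r ∓ 3t*` and `2t* + r − M`
are crossed monotonically. [cite: DafermosRodnianski2008, §5.1] -/
theorem strictMonoOn_clock {c : ℝ} (hc : |c| ≤ 2 / 3) (ha : |a| < M) (hs : s.OrdConnected)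
    (hγ : (Kerr.smoothMetric M a M).IsFutureCausalCurveOn
      ((Kerr.timeOrientation M a M hM).ofLE le_top) γ s) :
    StrictMonoOn (fun σ => (γ σ : E4) 0 + c * Kerr.radius a (γ σ)) s := by
  refine strictMonoOn_of_deriv_pos hs.convex
    (fun t ht => (hasDerivAt_clock c hγ ht).continuousAt.continuousWithinAt) fun t ht => ?_
  have ht' := interior_subset ht
  rw [(hasDerivAt_clock c hγ ht').deriv]
  have h1 := abs_deriv_radius_lt ha hγ ht'
  obtain ⟨-, -, hv0⟩ := causal_velocity hγ ht'
  set ρ := Kerr.radiusGrad a (E4.spatial (γ t : E4)) (E4.spatial (deriv (fun σ => (γ σ : E4)) t))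
  have h2 : |c * ρ| ≤ 2 / 3 * |ρ| := by rw [abs_mul]; exact mul_le_mul_of_nonneg_right hc (abs_nonneg _)
  have h3 : -(c * ρ) ≤ |c * ρ| := neg_le_abs _
  nlinarith [abs_nonneg ρ]

/-- **The hole clock along causal curves**: on a parameter interval where a future causal curve of the
chart stays in `{r < r₊}` (and `r > M > r₋` throughout the chart, `|a| < M`), `r` is strictly decreasing
(`clock_neg` with the slope of `exists_hole_slope`). [cite: ONeill1995, Ch. 2] -/
theorem strictAntiOn_radius (ha : |a| < M) {s' : Set ℝ} (hs' : s'.OrdConnected) (hsub : s' ⊆ s)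
    (hγ : (Kerr.smoothMetric M a M).IsFutureCausalCurveOn
      ((Kerr.timeOrientation M a M hM).ofLE le_top) γ s)
    (hlt : ∀ σ ∈ s', Kerr.radius a (γ σ) < Kerr.rPlus M a) :
    StrictAntiOn (fun σ => Kerr.radius a (γ σ)) s' := by
  refine strictAntiOn_of_deriv_neg hs'.convex
    (fun t ht => (hasDerivAt_radius hγ (hsub ht)).continuousAt.continuousWithinAt) fun t ht => ?_
  have ht' := interior_subset ht
  rw [(hasDerivAt_radius hγ (hsub ht')).deriv]
  obtain ⟨-, hc, hv0⟩ := causal_velocity hγ (hsub ht')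
  have hx : 0 < Kerr.radius a (γ t) := Kerr.radius_pos_of_mem_region (γ t).2
  have hm : Kerr.rMinus M a < Kerr.radius a (γ t) :=
    (F1Route.rMinus_lt_self ha).trans (Kerr.lt_radius_of_mem_region (γ t).2)
  obtain ⟨K, hK, hnum, hco⟩ := exists_hole_slope ha hx hm (hlt t ht')
  have hne : deriv (fun σ => (γ σ : E4)) t ≠ 0 := fun h0 => by rw [h0] at hv0; simp at hv0
  have hVv : Kerr.bilin M a (γ t) (Kerr.timeVector M a (γ t)) (deriv (fun σ => (γ σ : E4)) t) < 0 := by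
    rw [Kerr.bilin_timeVector hx]; linarith
  have key := clock_neg hM hx hnum hco hc hne hVv
  by_contra hge
  push Not at hge
  nlinarith [mul_nonneg hK.le hge]

/-- **Integrated hole clock**: a future causal curve of the chart on `[b₀, b₁]` starting in `{r < r₊}`
never exceeds its initial radius, `r(γ t) ≤ r(γ b₀)` (continuous induction: where `r ≤ r(γ b₀) < r₊`
holds, it holds a little further by `strictAntiOn_radius`, and the set where it holds is closed).  Hence
no future causal curve leaves the black-hole region `{M < r < r₊}` of the chart. [cite: ONeill1995, Ch. 2] -/
theorem radius_le_of_radius_lt_rPlus (ha : |a| < M) {b₀ b₁ : ℝ}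
    (hγ : (Kerr.smoothMetric M a M).IsFutureCausalCurveOn
      ((Kerr.timeOrientation M a M hM).ofLE le_top) γ (Icc b₀ b₁))
    (h0 : Kerr.radius a (γ b₀) < Kerr.rPlus M a) :
    ∀ t ∈ Icc b₀ b₁, Kerr.radius a (γ t) ≤ Kerr.radius a (γ b₀) := by
  set S : Set ℝ := {t | Kerr.radius a (γ t) ≤ Kerr.radius a (γ b₀)} with hS
  suffices h : Icc b₀ b₁ ⊆ S from fun t ht => h ht
  have hcont : ContinuousOn (fun t => Kerr.radius a (γ t)) (Icc b₀ b₁) :=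
    fun t ht => (hasDerivAt_radius hγ ht).continuousAt.continuousWithinAt
  refine IsClosed.Icc_subset_of_forall_mem_nhdsWithin ?_
    (show Kerr.radius a (γ b₀) ≤ Kerr.radius a (γ b₀) from le_rfl) ?_
  · have := hcont.preimage_isClosed_of_isClosed isClosed_Icc (isClosed_Iic (a := Kerr.radius a (γ b₀)))
    rwa [inter_comm] at this
  · rintro x ⟨hxS, hxa, hxb⟩
    have hxlt : Kerr.radius a (γ x) < Kerr.rPlus M a := lt_of_le_of_lt hxS h0
    have hct : ContinuousAt (fun t => Kerr.radius a (γ t)) x :=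
      (hasDerivAt_radius hγ ⟨hxa, hxb.le⟩).continuousAt
    obtain ⟨δ, hδ, hδlt⟩ := Metric.eventually_nhds_iff.1 (hct.preimage_mem_nhds (Iio_mem_nhds hxlt))
    have hm : x < min (x + δ) b₁ := lt_min (by linarith) hxb
    filter_upwards [Ioo_mem_nhdsGT hm] with t ht
    have htb : t ≤ b₁ := (ht.2.trans_le (min_le_right _ _)).le
    have htδ : t < x + δ := ht.2.trans_le (min_le_left _ _)
    have hsub : Icc x t ⊆ Icc b₀ b₁ := Icc_subset_Icc hxa htb
    have hanti := strictAntiOn_radius ha ordConnected_Icc hsub hγ fun σ hσ => hδlt (by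
      rw [Real.dist_eq, abs_lt]; constructor <;> linarith [hσ.1, hσ.2])
    show Kerr.radius a (γ t) ≤ Kerr.radius a (γ b₀)
    exact (hanti.antitoneOn (left_mem_Icc.2 ht.1.le) (right_mem_Icc.2 ht.1.le) ht.1.le).trans hxS

end KerrCausal

/-- **Registered bookkeeping sub-goal `stub_kerrCausalClocks` of the line** (brick of the landing of
K2b-2 `stub_slabFrontier`): along future CAUSAL curves of the Kerr star chart `{r > M}` (`0 ≤ M`,
`|a| < M`) on an interval, every clock `t* + c r` with `|c| ≤ 2/3` is strictly increasing
(`KerrCausal.strictMonoOn_clock`: speed limit `‖v⃗‖_δ ≤ v⁰` and `|∇r|_δ ≤ √2 < 3/2`).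
[cite: DafermosRodnianski2008, §5.1] -/
theorem stub_kerrCausalClocks : ∀ [Kerr.Facts] (M a : ℝ) (hM : 0 ≤ M), |a| < M → ∀ (c : ℝ), |c| ≤ 2 / 3 →
    ∀ (γ : ℝ → Kerr.region a M) (s : Set ℝ), s.OrdConnected →
      (Kerr.smoothMetric M a M).IsFutureCausalCurveOn ((Kerr.timeOrientation M a M hM).ofLE le_top) γ s →
      StrictMonoOn (fun σ => (γ σ : E4) 0 + c * Kerr.radius a (γ σ)) s :=
  fun _ _ _ ha _ hc _ _ hs hγ => KerrCausal.strictMonoOn_clock hc ha hs hγ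

end Summit.FinalStateConjecture.FinalStateConjecture.Theorems.BondiBartnikRigidity.DirectMethod

end
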